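import Mathlib.FieldTheory.Differential.Liouville
import Literature.NumberTheory.Transcendental.AxSchanuelWeierstrassHom
import HarnessLib

/-!
# Galois averaging for the elliptic invariant differential (descent of `Σ cᵢ ζ(Pᵢ)(∂) = a`)

Topic `Literature/NumberTheory/Transcendental`. Third support file for discharging the named
fact `Literature.NumberTheory.Transcendental.ax_schanuel_weierstrass` (`AxSchanuelWeierstrass.lean`;
J. Kirby, Selecta Math. 15 (2009), Thm. 3.8 for `S = Eⁿ`). Everything here is PROVED.

This is the elliptic counterpart of `LiouvilleDescent.lean` (Rosenlicht 1976, proof of Prop. 4: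
"replace `K` by a finite normal extension … apply the trace"): there an identity
`a = Σ cᵢ uᵢ′/uᵢ + v′` over a finite extension `K/F` of differential fields descends to `F`
because the trace of a logarithmic derivative is the logarithmic derivative of the norm. Here
the multiplicative group is replaced by an elliptic curve `E : y² = x³ + a₄x + a₆` over `F` with
constant coefficients, `u′/u` by `λ(P) = ζ(P)(∂) = x′/(2y)` (`AxSchanuelWeierstrassHom.lean`), and
the norm by the TRACE OF POINTS `Σ_σ σP ∈ E(K)^{Gal} = E(F)`: by Kirby 2009, Lemma 3.1
(`invDiff_sum`) `Σ_σ λ(σPᵢ) = λ(Σ_σ σPᵢ)`, and `λ(σP) = σ(λ(P))` (`invDiff_map`).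

**Statement** (`exists_nat_mul_eq_sum_invDiff`). `K/F` a finite extension of differential
fields of characteristic zero, `E` as above, `a, cᵢ ∈ F`, `Pᵢ ∈ E(K)` with
`a = Σ cᵢ λ(Pᵢ)` in `K`. Then `N a = Σ cᵢ μᵢ` in `F` for some integer `N ≥ 1`, where each `μᵢ`
is `0` or `U′/(2V)` for an affine point `(U, V) ∈ E(F)` with `V ≠ 0`.

## References

* J. Kirby, Selecta Math. (N.S.) 15 (2009), 445–486, Lemma 3.1.
* M. Rosenlicht, Pacific J. Math. 65 (1976), 485–492, proof of Prop. 4 (the averaging).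
-/

noncomputable section

namespace Literature.NumberTheory.Transcendental

namespace AxSchanuelWeierstrass

open scoped _root_.Differential
open _root_.Differential _root_.IntermediateField Finset _root_.WeierstrassCurve
  _root_.WeierstrassCurve.Affine

/-! ### Functoriality of `λ` -/

section Map

variable {R S F K : Type*} [CommRing R] [CommRing S] [Field F] [Field K] [Algebra R S]
  [Algebra R F] [Algebra S F] [IsScalarTower R S F] [Algebra R K] [Algebra S K]
  [IsScalarTower R S K] [DecidableEq F] [DecidableEq K] {W : Affine R}

omit [DecidableEq F] in
/-- The denominator of `λ`: `2y + a₁x + a₃ = y - negY(x, y)`. [folklore] -/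
theorem den_eq_sub_negY (W' : Affine F) (u v : F) :
    2 * v + W'.a₁ * u + W'.a₃ = v - W'.negY u v := by
  rw [WeierstrassCurve.Affine.negY]; ring

/-- `λ` is functorial: for an algebra map `f` intertwining the derivations,
`λ_{∂_K}(f(P)) = f(λ_{∂_F}(P))`. [folklore] -/
theorem invDiff_map (f : F →ₐ[S] K) {DF : Derivation ℤ F F} {DK : Derivation ℤ K K}
    (hf : ∀ x, f (DF x) = DK (f x)) (P : (W⁄F).Point) :
    invDiff (W⁄K) DK (Point.map f P) = f (invDiff (W⁄F) DF P) := by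
  rcases P with _ | ⟨x, y, h⟩
  · change invDiff (W⁄K) DK (Point.map f 0) = f (invDiff (W⁄F) DF 0)
    rw [map_zero, invDiff_zero, invDiff_zero, map_zero]
  · rw [Point.map_some, invDiff_some, invDiff_some, den_eq_sub_negY, den_eq_sub_negY, map_div₀,
      hf, map_sub, baseChange_negY]

end Map

/-! ### Galois averaging -/

section Galois

variable {F K : Type*} [Field F] [Field K] [Differential F] [Differential K] [CharZero F]
  [Algebra F K] [DifferentialAlgebra F K] [DecidableEq F] [DecidableEq K] {W : Affine F}

omit [CharZero F] [DecidableEq F] [DecidableEq K] in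
/-- Base change preserves "short Weierstrass with constant coefficients". [folklore] -/
theorem IsShortConst.baseChange (hW : IsShortConst W Differential.deriv) :
    IsShortConst (W⁄K) Differential.deriv where
  a₁ := by simp [hW.a₁]
  a₂ := by simp [hW.a₂]
  a₃ := by simp [hW.a₃]
  a₄ := by
    change (algebraMap F K W.a₄)′ = 0
    rw [deriv_algebraMap, show W.a₄′ = 0 from hW.a₄, map_zero]
  a₆ := by
    change (algebraMap F K W.a₆)′ = 0
    rw [deriv_algebraMap, show W.a₆′ = 0 from hW.a₆, map_zero]

/-- **Galois averaging for `λ`** (the elliptic analogue of Rosenlicht's trace argument). Let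
`K/F` be a finite Galois extension of differential fields of characteristic zero, `N = [K : F]`,
`E : y² = x³ + a₄x + a₆` over `F` with `a₄′ = a₆′ = 0`. If `a = Σ cᵢ λ(Pᵢ)` in `K` with
`a, cᵢ ∈ F` and `Pᵢ ∈ E(K)`, then `N a = Σ cᵢ μᵢ` with each `μᵢ = λ(Σ_σ σPᵢ) ∈ F`, i.e. `μᵢ = 0`
or `μᵢ = U′/(2V)` for an affine `F`-point `(U, V)` of `E` with `V ≠ 0`.
[cite: Kirby2009, Lemma 3.1] -/
theorem exists_nat_mul_eq_sum_invDiff_of_isGalois [FiniteDimensional F K] [IsGalois F K]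
    (hW : IsShortConst W Differential.deriv) (a : F) {ι : Type*} [Fintype ι] (c : ι → F)
    (P : ι → (W⁄K).Point)
    (h : algebraMap F K a = ∑ i, algebraMap F K (c i) * invDiff (W⁄K) Differential.deriv (P i)) :
    ∃ N : ℕ, N ≠ 0 ∧ ∃ μ : ι → F,
      (∀ i, μ i = 0 ∨ ∃ U V : F, V ^ 2 = U ^ 3 + W.a₄ * U + W.a₆ ∧ V ≠ 0 ∧ μ i = U′ / (2 * V)) ∧
      (N : F) * a = ∑ i, c i * μ i := by
  classical
  haveI : CharZero K :=
    charZero_of_injective_algebraMap (FaithfulSMul.algebraMap_injective F K)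
  have hWK : IsShortConst (W⁄K) Differential.deriv := hW.baseChange
  set G := K ≃ₐ[F] K
  have ffb : fixedField (⊤ : Subgroup G) = ⊥ :=
    (IsGalois.tfae.out 0 1).mp (inferInstance : IsGalois F K)
  -- traces of the points
  let Q : ι → (W⁄K).Point := fun i => ∑ σ : G, Point.map (σ : K →ₐ[F] K) (P i)
  have hQ : ∀ i (τ : G), Point.map (τ : K →ₐ[F] K) (Q i) = Q i := by
    intro i τ
    simp only [Q, map_sum, Point.map_map]
    exact Fintype.sum_equiv (Equiv.mulLeft τ) _ _ fun σ => rfl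
  -- their `λ`-values lie in `F`
  have hμ : ∀ i, ∃ m : F, (m = 0 ∨ ∃ U V : F, V ^ 2 = U ^ 3 + W.a₄ * U + W.a₆ ∧ V ≠ 0 ∧
      m = U′ / (2 * V)) ∧ algebraMap F K m = invDiff (W⁄K) Differential.deriv (Q i) := by
    intro i
    rcases hQi : Q i with _ | ⟨x, y, hxy⟩
    · exact ⟨0, Or.inl rfl, by rw [map_zero]; rfl⟩
    · -- the coordinates are fixed by the Galois group
      have hfix : ∀ τ : G, τ x = x ∧ τ y = y := by
        intro τ
        have := hQ i τ
        rw [hQi, Point.map_some] at this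
        simp only [Point.some.injEq] at this
        exact ⟨this.1, this.2⟩
      have hx : x ∈ fixedField (⊤ : Subgroup G) := fun τ => (hfix τ).1
      have hy : y ∈ fixedField (⊤ : Subgroup G) := fun τ => (hfix τ).2
      rw [ffb, IntermediateField.mem_bot] at hx hy
      obtain ⟨U, rfl⟩ := hx
      obtain ⟨V, rfl⟩ := hy
      have hEq : V ^ 2 = U ^ 3 + W.a₄ * U + W.a₆ := by
        have h1 := hWK.equation hxy.1
        rw [show (W⁄K).a₄ = algebraMap F K W.a₄ from rfl,
          show (W⁄K).a₆ = algebraMap F K W.a₆ from rfl] at h1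
        apply FaithfulSMul.algebraMap_injective F K
        simpa only [map_pow, map_add, map_mul] using h1
      by_cases hV : V = 0
      · refine ⟨0, Or.inl rfl, ?_⟩
        rw [invDiff_some, hWK.den, hV, map_zero, mul_zero, div_zero]
      · refine ⟨U′ / (2 * V), Or.inr ⟨U, V, hEq, hV, rfl⟩, ?_⟩
        rw [invDiff_some, hWK.den, deriv_algebraMap, map_div₀, map_mul, map_ofNat]
  choose μ hμ hμK using hμ
  refine ⟨Fintype.card G, Fintype.card_ne_zero, μ, hμ, ?_⟩
  -- the identity, in `K`: sum the conjugates of `h`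
  apply FaithfulSMul.algebraMap_injective F K
  have hσ : ∀ σ : G, algebraMap F K a =
      ∑ i, algebraMap F K (c i) * invDiff (W⁄K) Differential.deriv (Point.map (σ : K →ₐ[F] K) (P i)) := by
    intro σ
    have := congrArg σ h
    rw [AlgEquiv.commutes, map_sum] at this
    rw [this]
    refine Finset.sum_congr rfl fun i _ => ?_
    rw [map_mul, AlgEquiv.commutes, invDiff_map (σ : K →ₐ[F] K) (fun x => algEquiv_deriv' σ x)]
    rfl
  have hsum := Finset.sum_congr rfl fun (σ : G) (_ : σ ∈ Finset.univ) => hσ σ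
  rw [Finset.sum_const, Finset.card_univ, nsmul_eq_mul] at hsum
  rw [map_mul, map_natCast, hsum, Finset.sum_comm, map_sum]
  refine Finset.sum_congr rfl fun i _ => ?_
  rw [← Finset.mul_sum, map_mul, hμK, ← invDiff_sum hWK]

end Galois

/-! ### Finite extensions -/

section General

variable {F K : Type*} [Field F] [Field K] [Differential F] [Differential K] [CharZero F]
  [Algebra F K] [DifferentialAlgebra F K] [DecidableEq F] [DecidableEq K] {W : Affine F}

/-- **Descent of `a = Σ cᵢ λ(Pᵢ)` along a finite extension** of differential fields of
characteristic zero (embed in a normal closure and average over its Galois group,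
`exists_nat_mul_eq_sum_invDiff_of_isGalois`): `N a = Σ cᵢ μᵢ` in `F` with `N ≥ 1` and each
`μᵢ` zero or `U′/(2V)` for an affine `F`-point `(U, V)`, `V ≠ 0`, of
`E : y² = x³ + a₄x + a₆` (`a₄′ = a₆′ = 0`). [cite: Kirby2009, Lemma 3.1] -/
theorem exists_nat_mul_eq_sum_invDiff [FiniteDimensional F K]
    (hW : IsShortConst W Differential.deriv) (a : F) {ι : Type*} [Fintype ι] (c : ι → F)
    (P : ι → (W⁄K).Point)
    (h : algebraMap F K a = ∑ i, algebraMap F K (c i) * invDiff (W⁄K) Differential.deriv (P i)) :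
    ∃ N : ℕ, N ≠ 0 ∧ ∃ μ : ι → F,
      (∀ i, μ i = 0 ∨ ∃ U V : F, V ^ 2 = U ^ 3 + W.a₄ * U + W.a₆ ∧ V ≠ 0 ∧ μ i = U′ / (2 * V)) ∧
      (N : F) * a = ∑ i, c i * μ i := by
  classical
  -- a normal closure `E` of (a copy `K'` of) `K` inside an algebraic closure of `F`
  let φ₀ : K →ₐ[F] AlgebraicClosure F := IsAlgClosed.lift (M := AlgebraicClosure F) (R := F) (S := K)
  let K' : IntermediateField F (AlgebraicClosure F) := φ₀.fieldRange
  haveI : FiniteDimensional F K' := LinearMap.finiteDimensional_range φ₀.toLinearMap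
  let E : IntermediateField F (AlgebraicClosure F) := normalClosure F K' (AlgebraicClosure F)
  let φ : K →ₐ[F] E :=
    (IntermediateField.inclusion (IntermediateField.le_normalClosure K')).comp
      (AlgEquiv.ofInjectiveField φ₀).toAlgHom
  have hφ : Function.Injective φ := φ.toRingHom.injective
  have hφd : ∀ x : K, φ (x′) = (φ x)′ := fun x => algHom_deriv' φ hφ x
  -- transport the identity to `E`
  have h' : algebraMap F E a =
      ∑ i, algebraMap F E (c i) * invDiff (W⁄E) Differential.deriv (Point.map φ (P i)) := by
    have := congrArg φ h
    rw [AlgHom.commutes, map_sum] at this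
    rw [this]
    refine Finset.sum_congr rfl fun i _ => ?_
    rw [map_mul, AlgHom.commutes, invDiff_map φ hφd]
  exact exists_nat_mul_eq_sum_invDiff_of_isGalois hW a c _ h'

end General

end AxSchanuelWeierstrass

end Literature.NumberTheory.Transcendental
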